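import Summits.NavierStokesRegularity.NavierStokesRegularity.Theorems.SqueezeCycleRecurrentLiouvilleOrbitContinuous
import Summits.NavierStokesRegularity.NavierStokesRegularity.Theorems.RecurrentProfilesRecurrentReductionOrbit
import HarnessLib

/-!
# Crux `RecurrentLiouville` (stmt-NavierStokesRegularity-1589), line `Sketch` (v9) — stub `stub_prJointContinuity`:
# sequential joint continuity of the scaling flow in `L³_loc`

Theorems-only file (no definitions, no named facts), pure real analysis.  Write
`Q(0, R) = ]-R², 0[ × B(0, R)` (`parabolicCylinder R 0`) for the backward parabolic ball at the
origin of `ℝ × ℝ³` and `u_c(t, x) = c u(c² t, c x)` (`nsRescale c u`) for the Navier–Stokes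
rescaling of a space–time field.

**Statement** (`stub_prJointContinuity`).  Let `wₙ, v : ℝ → ℝ³ → ℝ³` lie in `L³(Q(0, R))` for
every `R > 0`, with `wₙ → v` in `L³(Q(0, R))` for every `R > 0`, and let `cₙ → c₀` be positive
scales with `c₀ > 0`.  Then `(wₙ)_{cₙ} → v_{c₀}` in `L³(Q(0, R))` for every `R > 0`; i.e. the
scaling flow `(c, w) ↦ w_c` of the multiplicative group `(0, ∞)` on `L³_loc` of the backward slab
is JOINTLY (sequentially) continuous.

**Proof.**  Fix `R > 0` and split
`(wₙ)_{cₙ} − v_{c₀} = [(wₙ)_{cₙ} − v_{cₙ}] + [v_{cₙ} − v_{c₀}]` (Minkowski, `eLpNorm_add_le`).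
* By the exact scaling law of `L³` distances (`eLpNorm_zoom_sub_zoom`, `nsRescale_eq_zoom`),
  `‖(wₙ)_{cₙ} − v_{cₙ}‖_{L³(Q(0,R))} = K(cₙ) ‖wₙ − v‖_{L³(Q(0, cₙ R))}` with
  `K(c) = c (c⁵)^{-1/3}`; eventually `cₙ ∈ (c₀/2, 2c₀)`, where `K(cₙ) ≤ 2c₀ ((c₀/2)⁵)^{-1/3}`
  (`prJC_zoomConst_le`) and `Q(0, cₙ R) ⊆ Q(0, 2c₀ R)`, so the first term is at most a finite
  constant times `‖wₙ − v‖_{L³(Q(0, 2c₀R))} → 0`.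
* `v_{cₙ} = (v_{cₙ/c₀})_{c₀}` (`nsRescale_mul`), so again by the scaling law
  `‖v_{cₙ} − v_{c₀}‖_{L³(Q(0,R))} = K(c₀) ‖v_{cₙ/c₀} − v‖_{L³(Q(0, c₀ R))} → 0` by the continuity
  of the scaling orbit of `v` at `1` (`stub_rlOrbitContinuous`) along `cₙ/c₀ → 1`.
A squeeze between `0` and the sum of the two majorants concludes.

## References

* D. Albritton, T. Barker, *Global weak Besov solutions of the Navier–Stokes equations and
  applications*, J. Math. Fluid Mech. 21 (2019), no. 43 = arXiv:1811.00502, §3 (the `L³_loc`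
  setting of rescaled suitable weak solutions on the backward slab). [AlbrittonBarker2019]
* The lemma itself (strong continuity of the dilation group on `L^p_loc`) is folklore; cf.
  W. Rudin, *Real and Complex Analysis*, 3rd ed., Thm. 9.5. [folklore]
-/

noncomputable section

-- the sub-problem namespace repeats the summit name (D-0017 layout `Summit.<S>.<P>.Theorems`)
set_option linter.dupNamespace false

namespace Summit.NavierStokesRegularity.NavierStokesRegularity.Theorems

open MeasureTheory Set Function Filter Topology TopologicalSpace Metric
open Literature.Analysis Literature.Analysis.FluidPDE
open scoped NNReal ENNReal

/-- The scaling constant `c (c⁵)^{-1/3}` of the exact `L³` scaling law is at most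
`2c₀ ((c₀/2)⁵)^{-1/3}` for `c ∈ (c₀/2, 2c₀)`, `c₀ > 0`. [folklore] -/
private theorem prJC_zoomConst_le {c₀ c : ℝ} (hc₀ : 0 < c₀) (hc : c ∈ Ioo (c₀ / 2) (2 * c₀)) :
    ‖c‖ₑ * (ENNReal.ofReal (c ^ 2 * c ^ 3)⁻¹) ^ (1 / (3 : ℝ≥0∞).toReal) ≤
      ENNReal.ofReal (2 * c₀) * ENNReal.ofReal ((c₀ / 2) ^ 5)⁻¹ ^ (1 / (3 : ℝ≥0∞).toReal) := by
  have hc0 : 0 < c := lt_trans (half_pos hc₀) hc.1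
  refine mul_le_mul' ?_ ?_
  · rw [Real.enorm_eq_ofReal hc0.le]
    exact ENNReal.ofReal_le_ofReal hc.2.le
  · refine ENNReal.rpow_le_rpow (ENNReal.ofReal_le_ofReal ?_) (by norm_num)
    have h5 : (c₀ / 2) ^ 5 ≤ c ^ 5 := pow_le_pow_left₀ (half_pos hc₀).le hc.1.le 5
    calc (c ^ 2 * c ^ 3)⁻¹ = (c ^ 5)⁻¹ := by ring
      _ ≤ ((c₀ / 2) ^ 5)⁻¹ := inv_anti₀ (by positivity) h5

/-- **Sequential joint continuity of the scaling flow in `L³_loc`.**  If `wₙ → v` in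
`L³(Q(0, R))` for every `R > 0` (all fields lying in these spaces) and `cₙ → c₀` with
`cₙ, c₀ > 0`, then `(wₙ)_{cₙ} → v_{c₀}` in `L³(Q(0, R))` for every `R > 0`.  Split
`(wₙ)_{cₙ} − v_{c₀} = [(wₙ)_{cₙ} − v_{cₙ}] + [v_{cₙ} − v_{c₀}]`; the first term equals
`K(cₙ) ‖wₙ − v‖_{L³(Q(0, cₙR))}` by the exact scaling law (`eLpNorm_zoom_sub_zoom`), with `K(cₙ)`
eventually bounded (`prJC_zoomConst_le`) and `Q(0, cₙR) ⊆ Q(0, 2c₀R)` eventually; the second is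
`K(c₀) ‖v_{cₙ/c₀} − v‖_{L³(Q(0, c₀R))} → 0` by `nsRescale_mul` and the continuity of the scaling
orbit of `v` at `1` (`stub_rlOrbitContinuous`). [folklore] -/
theorem stub_prJointContinuity :
    ∀ (w : ℕ → ℝ → EuclideanSpace ℝ (Fin 3) → EuclideanSpace ℝ (Fin 3)) (v : ℝ → EuclideanSpace ℝ (Fin 3) → EuclideanSpace ℝ (Fin 3)),
      (∀ (n : ℕ) (R : ℝ), 0 < R → MemLp (uncurry (w n)) 3 (volume.restrict (parabolicCylinder R (0 : ℝ × EuclideanSpace ℝ (Fin 3))))) →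
      (∀ R : ℝ, 0 < R → MemLp (uncurry v) 3 (volume.restrict (parabolicCylinder R (0 : ℝ × EuclideanSpace ℝ (Fin 3))))) →
      (∀ R : ℝ, 0 < R → Tendsto (fun n => eLpNorm (uncurry (w n) - uncurry v) 3 (volume.restrict (parabolicCylinder R (0 : ℝ × EuclideanSpace ℝ (Fin 3))))) atTop (𝓝 0)) →
      ∀ (c : ℕ → ℝ) (c₀ : ℝ), (∀ n, 0 < c n) → 0 < c₀ → Tendsto c atTop (𝓝 c₀) →
        ∀ R : ℝ, 0 < R → Tendsto (fun n => eLpNorm (uncurry (nsRescale (c n) (w n)) -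
          uncurry (nsRescale c₀ v)) 3 (volume.restrict (parabolicCylinder R (0 : ℝ × EuclideanSpace ℝ (Fin 3))))) atTop (𝓝 0) := by
  intro w v hw hv hconv c c₀ hc hc₀ hcc R hR
  -- the two finite constants: `K₀` bounds `K(cₙ)` for `cₙ ∈ (c₀/2, 2c₀)`, `K₁ = K(c₀)`
  set K₀ : ℝ≥0∞ := ENNReal.ofReal (2 * c₀) *
    ENNReal.ofReal ((c₀ / 2) ^ 5)⁻¹ ^ (1 / (3 : ℝ≥0∞).toReal)
  have hK₀top : K₀ ≠ ⊤ :=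
    ENNReal.mul_ne_top ENNReal.ofReal_ne_top
      (ENNReal.rpow_ne_top_of_nonneg (by norm_num) ENNReal.ofReal_ne_top)
  set K₁ : ℝ≥0∞ := ‖c₀‖ₑ * (ENNReal.ofReal (c₀ ^ 2 * c₀ ^ 3)⁻¹) ^ (1 / (3 : ℝ≥0∞).toReal)
  have hK₁top : K₁ ≠ ⊤ := zoomConst_ne_top c₀
  -- the two vanishing quantities
  set e₁ : ℕ → ℝ≥0∞ := fun n => eLpNorm (uncurry (w n) - uncurry v) 3
    (volume.restrict (parabolicCylinder (2 * c₀ * R) (0 : ℝ × EuclideanSpace ℝ (Fin 3))))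
  set e₂ : ℕ → ℝ≥0∞ := fun n => eLpNorm (uncurry (nsRescale (c n / c₀) v) - uncurry v) 3
    (volume.restrict (parabolicCylinder (c₀ * R) (0 : ℝ × EuclideanSpace ℝ (Fin 3))))
  have h₁ : Tendsto e₁ atTop (𝓝 0) := hconv (2 * c₀ * R) (by positivity)
  have h₂ : Tendsto e₂ atTop (𝓝 0) := by
    have hq : Tendsto (fun n => c n / c₀) atTop (𝓝 1) := by
      have h := hcc.div_const c₀
      rwa [div_self hc₀.ne'] at h
    exact (stub_rlOrbitContinuous v hv (c₀ * R) (by positivity)).comp hq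
  have hsum : Tendsto (fun n => K₀ * e₁ n + K₁ * e₂ n) atTop (𝓝 0) := by
    have ha := (ENNReal.Tendsto.const_mul h₁ (Or.inr hK₀top)).add
      (ENNReal.Tendsto.const_mul h₂ (Or.inr hK₁top))
    simpa only [mul_zero, add_zero] using ha
  -- eventually `cₙ ∈ (c₀/2, 2c₀)`
  have hcI : ∀ᶠ n in atTop, c n ∈ Ioo (c₀ / 2) (2 * c₀) :=
    hcc.eventually_mem (Ioo_mem_nhds (by linarith) (by linarith))
  refine tendsto_of_tendsto_of_tendsto_of_le_of_le' tendsto_const_nhds hsum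
    (Eventually.of_forall fun _ => zero_le) ?_
  filter_upwards [hcI] with n hn
  have hcn : 0 < c n := hc n
  -- measurability of the three rescaled fields on `Q(0, R)`
  have hm1 : AEStronglyMeasurable (uncurry (nsRescale (c n) (w n)))
      (volume.restrict (parabolicCylinder R (0 : ℝ × EuclideanSpace ℝ (Fin 3)))) := by
    rw [nsRescale_eq_zoom (c n) (w n)]
    exact (memLp_three_zoom hcn (hw n (c n * R) (by positivity))).1
  have hm2 : AEStronglyMeasurable (uncurry (nsRescale (c n) v))
      (volume.restrict (parabolicCylinder R (0 : ℝ × EuclideanSpace ℝ (Fin 3)))) := by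
    rw [nsRescale_eq_zoom (c n) v]
    exact (memLp_three_zoom hcn (hv (c n * R) (by positivity))).1
  have hm3 : AEStronglyMeasurable (uncurry (nsRescale c₀ v))
      (volume.restrict (parabolicCylinder R (0 : ℝ × EuclideanSpace ℝ (Fin 3)))) := by
    rw [nsRescale_eq_zoom c₀ v]
    exact (memLp_three_zoom hc₀ (hv (c₀ * R) (by positivity))).1
  -- Term 1: `‖(wₙ)_{cₙ} − v_{cₙ}‖_{L³(Q(0,R))} = K(cₙ) ‖wₙ − v‖_{L³(Q(0,cₙR))} ≤ K₀ e₁ n`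
  have hT1 : eLpNorm (uncurry (nsRescale (c n) (w n)) - uncurry (nsRescale (c n) v)) 3
      (volume.restrict (parabolicCylinder R (0 : ℝ × EuclideanSpace ℝ (Fin 3)))) ≤ K₀ * e₁ n := by
    rw [nsRescale_eq_zoom (c n) (w n), nsRescale_eq_zoom (c n) v, eLpNorm_zoom_sub_zoom (w n) v hcn R]
    refine mul_le_mul' (prJC_zoomConst_le hc₀ hn) (eLpNorm_mono_measure _ (Measure.restrict_mono ?_ le_rfl))
    exact SuitableCompactness.parabolicCylinder_zero_mono (by positivity)
      (mul_le_mul_of_nonneg_right hn.2.le hR.le)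
  -- Term 2: `‖v_{cₙ} − v_{c₀}‖_{L³(Q(0,R))} = K(c₀) ‖v_{cₙ/c₀} − v‖_{L³(Q(0,c₀R))} = K₁ e₂ n`
  have hT2 : eLpNorm (uncurry (nsRescale (c n) v) - uncurry (nsRescale c₀ v)) 3
      (volume.restrict (parabolicCylinder R (0 : ℝ × EuclideanSpace ℝ (Fin 3)))) = K₁ * e₂ n := by
    have e : nsRescale (c n) v = nsRescale c₀ (nsRescale (c n / c₀) v) := by
      rw [← nsRescale_mul, div_mul_cancel₀ (c n) hc₀.ne']
    rw [e, nsRescale_eq_zoom c₀ (nsRescale (c n / c₀) v), nsRescale_eq_zoom c₀ v,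
      eLpNorm_zoom_sub_zoom _ v hc₀ R]
  -- Minkowski and the two terms
  calc eLpNorm (uncurry (nsRescale (c n) (w n)) - uncurry (nsRescale c₀ v)) 3
        (volume.restrict (parabolicCylinder R (0 : ℝ × EuclideanSpace ℝ (Fin 3))))
      = eLpNorm ((uncurry (nsRescale (c n) (w n)) - uncurry (nsRescale (c n) v)) +
          (uncurry (nsRescale (c n) v) - uncurry (nsRescale c₀ v))) 3
          (volume.restrict (parabolicCylinder R (0 : ℝ × EuclideanSpace ℝ (Fin 3)))) := by
        rw [sub_add_sub_cancel]
    _ ≤ eLpNorm (uncurry (nsRescale (c n) (w n)) - uncurry (nsRescale (c n) v)) 3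
          (volume.restrict (parabolicCylinder R (0 : ℝ × EuclideanSpace ℝ (Fin 3)))) +
        eLpNorm (uncurry (nsRescale (c n) v) - uncurry (nsRescale c₀ v)) 3
          (volume.restrict (parabolicCylinder R (0 : ℝ × EuclideanSpace ℝ (Fin 3)))) :=
        eLpNorm_add_le (hm1.sub hm2) (hm2.sub hm3) (by norm_num)
    _ ≤ K₀ * e₁ n + K₁ * e₂ n := add_le_add hT1 hT2.le

end Summit.NavierStokesRegularity.NavierStokesRegularity.Theorems
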